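import Summits.AtomisticToContinuum.Crystallization.Theorems.FrustratedLawDichotomyStrainedPatchHomLeafTableFoldHcpV
import Summits.AtomisticToContinuum.Crystallization.Theorems.FrustratedLawDichotomyStrainedPatchHomLeafTableSoundHcpA

/-!
# hcp vector-form leaf checker — the ACCUMULATOR SUMS of a passing fold in `ℤ`

decomp-a2c hand-2 g25 (crux `AperiodicFrustratedLawGap`, stmt-AtomisticToContinuum-27623; (H) hcp P-twin, critic rows 887/891/893).  Twin of the
`acc_sumsH` layer of hand-2 g24's `…HomLeafTableSoundHcpA` for the vector-form fold `foldV`: if `foldV tab k accV0 labs` passes, every record passes its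
step, and the signed accumulator fields are the sums over the TREATED records of the row data (value, `D̂·δ`, `Σδ`, the ten gradient classes as
`D̂ · cls j`, curvature `M(δ + R)²`, `sa = Σ aD`, `sr = Σ R`); plus the unpacking of `finalV`.  The record readings `NH.cls`, `NH.Lz`, `NH.mag` and the
cast lemma `cast_sum_sub_eqH` are hand-2 g24's, reused.  0 sorry; standard axioms.  `--supports stmt-AtomisticToContinuum-27623`.
-/

namespace Summit.AtomisticToContinuum.Crystallization.Theorems.FrustratedLawDichotomyStrainedPatchHomLeafTableCheckHcpV

open Summit.AtomisticToContinuum.Crystallization.Theorems.FrustratedLawDichotomyStrainedPatchHomLeafTableCheck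
  (Row QT sgnZ SCN addP addN sx absDiff addP_eq addN_eq addP_sub_addN sgnZ_mul sgnZ_sx natAbs_sgnZ)
open Summit.AtomisticToContinuum.Crystallization.Theorems.FrustratedLawDichotomyStrainedPatchHomLeafTableCheckHcp (NH NH.cls cast_sum_sub_eqH)

/-! ## §1. Readings -/

/-- The ten positive gradient-class parts of an accumulator. -/
def AccV.gP (a : AccV) : Fin 10 → ℕ := ![a.g0P, a.g1P, a.g2P, a.g3P, a.g4P, a.g5P, a.g6P, a.g7P, a.g8P, a.g9P]

/-- The ten negative gradient-class parts of an accumulator. -/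
def AccV.gN (a : AccV) : Fin 10 → ℕ := ![a.g0N, a.g1N, a.g2N, a.g3N, a.g4N, a.g5N, a.g6N, a.g7N, a.g8N, a.g9N]

/-- The signed class gradients as a function: `gV (gP j) (gN j) = gP j − gN j`. [formal bookkeeping] -/
theorem gV_eq (P N : ℕ) : gV P N = (P : ℤ) - (N : ℤ) := by
  unfold gV; exact Int.subNatNat_eq_coe

/-! ## §2. What a passing leaf check says in `ℤ` -/

/-- Unpacking `finalV`. [formal bookkeeping] -/
theorem finalV_true {E : ℕ} {k : LV} {sμ : Bool} {aμ : ℕ} {a : AccV} (h : finalV E k sμ aμ a = true) :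
    a.ok = true ∧ lhsV E (addP sμ aμ 0) (GV k a) a ≤ rhsV (addN sμ aμ 0) a := by
  unfold finalV at h
  simp only [Bool.and_eq_true, Nat.ble_eq] at h
  exact h

/-- Unpacking `leafCheckV`. [formal bookkeeping] -/
theorem leafCheckV_true {tab : QT} {labs : List NH} {E : ℕ} {k : LV} {sμ : Bool} {aμ : ℕ} (h : leafCheckV tab labs E k sμ aμ = true) :
    (foldV tab k accV0 labs).ok = true ∧
      lhsV E (addP sμ aμ 0) (GV k (foldV tab k accV0 labs)) (foldV tab k accV0 labs) ≤ rhsV (addN sμ aμ 0) (foldV tab k accV0 labs) :=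
  finalV_true h

/-- ★ **THE ACCUMULATOR SUMS.**  For a passing fold, with `T` = the treated records: every record passes its step, and the accumulator fields are the sums
over `T` of the per-record data read from the rows used. [formal bookkeeping] -/
theorem acc_sumsV {tab : QT} {k : LV} {labs : List NH} (hok : (foldV tab k accV0 labs).ok = true) :
    (∀ l ∈ labs, stepOKV tab k l = true) ∧
    (((foldV tab k accV0 labs).vP : ℤ) - (foldV tab k accV0 labs).vN =
      ((labs.filter (fun l => treatedV tab k l)).map (fun l => sgnZ (rowTV tab k l).sV (rowTV tab k l).aV)).sum) ∧
    (((foldV tab k accV0 labs).dP : ℤ) - (foldV tab k accV0 labs).dN =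
      ((labs.filter (fun l => treatedV tab k l)).map (fun l => sgnZ (rowTV tab k l).sD (rowTV tab k l).aD * (dltV tab k l : ℤ))).sum) ∧
    ((foldV tab k accV0 labs).sd = ((labs.filter (fun l => treatedV tab k l)).map (fun l => dltV tab k l)).sum) ∧
    (∀ j : Fin 10, (((foldV tab k accV0 labs).gP j : ℕ) : ℤ) - (foldV tab k accV0 labs).gN j =
      ((labs.filter (fun l => treatedV tab k l)).map (fun l => sgnZ (rowTV tab k l).sD (rowTV tab k l).aD * l.cls j)).sum) ∧
    ((foldV tab k accV0 labs).cur = ((labs.filter (fun l => treatedV tab k l)).map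
        (fun l => (rowTV tab k l).M * ((dltV tab k l + RV k l) * (dltV tab k l + RV k l)))).sum) ∧
    ((foldV tab k accV0 labs).sa = ((labs.filter (fun l => treatedV tab k l)).map (fun l => (rowTV tab k l).aD)).sum) ∧
    ((foldV tab k accV0 labs).sr = ((labs.filter (fun l => treatedV tab k l)).map (fun l => RV k l)).sum) := by
  rw [foldV_eq] at hok ⊢
  obtain ⟨-, hall, heq⟩ := foldl_stepV_eq tab k labs accV0 hok
  rw [heq]
  set T := labs.filter (fun l => treatedV tab k l) with hT
  have hTt : ∀ l ∈ T, treatedV tab k l = true := fun l hl => (List.mem_filter.1 hl).2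
  have hF := fun l (hl : l ∈ T) => incrV_fields (hTt l hl) (rowTV_eq_of_treated (hTt l hl))
  have e0 : ∀ (P N : AccV → ℕ), (∀ a c, P (a.add c) = P a + P c) → (∀ a c, N (a.add c) = N a + N c) → P accV0 = 0 → N accV0 = 0 →
      ∀ (hfn : NH → ℤ), (∀ l ∈ T, ((P (incrV tab k l) : ℕ) : ℤ) - ((N (incrV tab k l) : ℕ) : ℤ) = hfn l) →
      ((P (T.foldl (fun acc l => acc.add (incrV tab k l)) accV0) : ℕ) : ℤ) -
        ((N (T.foldl (fun acc l => acc.add (incrV tab k l)) accV0) : ℕ) : ℤ) = ((T.map hfn).sum : ℤ) := by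
    intro P N hP hN hP0 hN0 hfn hh
    rw [proj_sub_foldlV_add P N hP hN (incrV tab k) T accV0, hP0, hN0]
    have := cast_sum_sub_eqH (fun l => P (incrV tab k l)) (fun l => N (incrV tab k l)) hfn T hh
    simp only [Nat.cast_zero, sub_zero, zero_add]
    rw [← this]
  have e1 : ∀ (P : AccV → ℕ), (∀ a c, P (a.add c) = P a + P c) → P accV0 = 0 → ∀ (hfn : NH → ℕ), (∀ l ∈ T, P (incrV tab k l) = hfn l) →
      P (T.foldl (fun acc l => acc.add (incrV tab k l)) accV0) = ((T.map hfn).sum : ℕ) := by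
    intro P hP hP0 hfn hh
    rw [proj_foldlV_add P hP (incrV tab k) T accV0, hP0, Nat.zero_add]
    exact congrArg List.sum (List.map_congr_left hh)
  have hd : ∀ l ∈ T, QV k l - (rowTV tab k l).t = dltV tab k l := fun _ _ => rfl
  refine ⟨hall, ?_, ?_, ?_, ?_, ?_, ?_, ?_⟩
  · exact e0 AccV.vP AccV.vN (fun _ _ => rfl) (fun _ _ => rfl) rfl rfl _ (fun l hl => (hF l hl).2.1)
  · exact e0 AccV.dP AccV.dN (fun _ _ => rfl) (fun _ _ => rfl) rfl rfl _ (fun l hl => (hF l hl).2.2.1)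
  · exact e1 AccV.sd (fun _ _ => rfl) rfl _ (fun l hl => (hF l hl).2.2.2.1)
  · intro j
    fin_cases j
    · exact e0 AccV.g0P AccV.g0N (fun _ _ => rfl) (fun _ _ => rfl) rfl rfl _ (fun l hl => by simpa [AccV.gP, AccV.gN, NH.cls] using (hF l hl).2.2.2.2.1)
    · exact e0 AccV.g1P AccV.g1N (fun _ _ => rfl) (fun _ _ => rfl) rfl rfl _ (fun l hl => by simpa [AccV.gP, AccV.gN, NH.cls] using (hF l hl).2.2.2.2.2.1)
    · exact e0 AccV.g2P AccV.g2N (fun _ _ => rfl) (fun _ _ => rfl) rfl rfl _ (fun l hl => by simpa [AccV.gP, AccV.gN, NH.cls] using (hF l hl).2.2.2.2.2.2.1)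
    · exact e0 AccV.g3P AccV.g3N (fun _ _ => rfl) (fun _ _ => rfl) rfl rfl _ (fun l hl => by simpa [AccV.gP, AccV.gN, NH.cls] using (hF l hl).2.2.2.2.2.2.2.1)
    · exact e0 AccV.g4P AccV.g4N (fun _ _ => rfl) (fun _ _ => rfl) rfl rfl _ (fun l hl => by simpa [AccV.gP, AccV.gN, NH.cls] using (hF l hl).2.2.2.2.2.2.2.2.1)
    · exact e0 AccV.g5P AccV.g5N (fun _ _ => rfl) (fun _ _ => rfl) rfl rfl _
        (fun l hl => by simpa [AccV.gP, AccV.gN, NH.cls] using (hF l hl).2.2.2.2.2.2.2.2.2.1)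
    · exact e0 AccV.g6P AccV.g6N (fun _ _ => rfl) (fun _ _ => rfl) rfl rfl _
        (fun l hl => by simpa [AccV.gP, AccV.gN, NH.cls] using (hF l hl).2.2.2.2.2.2.2.2.2.2.1)
    · exact e0 AccV.g7P AccV.g7N (fun _ _ => rfl) (fun _ _ => rfl) rfl rfl _
        (fun l hl => by simpa [AccV.gP, AccV.gN, NH.cls] using (hF l hl).2.2.2.2.2.2.2.2.2.2.2.1)
    · exact e0 AccV.g8P AccV.g8N (fun _ _ => rfl) (fun _ _ => rfl) rfl rfl _
        (fun l hl => by simpa [AccV.gP, AccV.gN, NH.cls] using (hF l hl).2.2.2.2.2.2.2.2.2.2.2.2.1)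
    · exact e0 AccV.g9P AccV.g9N (fun _ _ => rfl) (fun _ _ => rfl) rfl rfl _
        (fun l hl => by simpa [AccV.gP, AccV.gN, NH.cls] using (hF l hl).2.2.2.2.2.2.2.2.2.2.2.2.2.1)
  · exact e1 AccV.cur (fun _ _ => rfl) rfl _ (fun l hl => (hF l hl).2.2.2.2.2.2.2.2.2.2.2.2.2.2.1)
  · exact e1 AccV.sa (fun _ _ => rfl) rfl _ (fun l hl => (hF l hl).2.2.2.2.2.2.2.2.2.2.2.2.2.2.2.1)
  · exact e1 AccV.sr (fun _ _ => rfl) rfl _ (fun l hl => (hF l hl).2.2.2.2.2.2.2.2.2.2.2.2.2.2.2.2)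

/-- The signed class gradient `j` of a passing fold, via `gV`. [formal bookkeeping] -/
theorem gV_foldV_eq {tab : QT} {k : LV} {labs : List NH} (hok : (foldV tab k accV0 labs).ok = true) (j : Fin 10) :
    gV ((foldV tab k accV0 labs).gP j) ((foldV tab k accV0 labs).gN j) =
      ((labs.filter (fun l => treatedV tab k l)).map (fun l => sgnZ (rowTV tab k l).sD (rowTV tab k l).aD * l.cls j)).sum := by
  rw [gV_eq]; exact (acc_sumsV hok).2.2.2.2.1 j

/-- Magnitude sums of an accumulator field pair: `gP j + gN j = Σ_T aD · mag j`. [formal bookkeeping] -/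
theorem gP_add_gN_foldV_eq {tab : QT} {k : LV} {labs : List NH} (hok : (foldV tab k accV0 labs).ok = true) (j : Fin 10) :
    (foldV tab k accV0 labs).gP j + (foldV tab k accV0 labs).gN j =
      ((labs.filter (fun l => treatedV tab k l)).map (fun l => (rowTV tab k l).aD * l.mag j)).sum := by
  rw [foldV_eq] at hok ⊢
  obtain ⟨-, -, heq⟩ := foldl_stepV_eq tab k labs accV0 hok
  rw [heq]
  set T := labs.filter (fun l => treatedV tab k l) with hT
  have hTt : ∀ l ∈ T, treatedV tab k l = true := fun l hl => (List.mem_filter.1 hl).2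
  have hG := fun l (hl : l ∈ T) => incrV_gP_add_gN (hTt l hl) (rowTV_eq_of_treated (hTt l hl))
  have e2 : ∀ (P N : AccV → ℕ), (∀ a c, P (a.add c) = P a + P c) → (∀ a c, N (a.add c) = N a + N c) → P accV0 = 0 → N accV0 = 0 →
      ∀ (hfn : NH → ℕ), (∀ l ∈ T, P (incrV tab k l) + N (incrV tab k l) = hfn l) →
      P (T.foldl (fun acc l => acc.add (incrV tab k l)) accV0) + N (T.foldl (fun acc l => acc.add (incrV tab k l)) accV0) = (T.map hfn).sum := by
    intro P N hP hN hP0 hN0 hfn hh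
    rw [proj_foldlV_add P hP (incrV tab k) T accV0, proj_foldlV_add N hN (incrV tab k) T accV0, hP0, hN0, Nat.zero_add, Nat.zero_add,
      ← List.sum_map_add]
    exact congrArg List.sum (List.map_congr_left hh)
  fin_cases j
  · exact e2 AccV.g0P AccV.g0N (fun _ _ => rfl) (fun _ _ => rfl) rfl rfl _ (fun l hl => by simpa [NH.mag] using (hG l hl).1)
  · exact e2 AccV.g1P AccV.g1N (fun _ _ => rfl) (fun _ _ => rfl) rfl rfl _ (fun l hl => by simpa [NH.mag] using (hG l hl).2.1)
  · exact e2 AccV.g2P AccV.g2N (fun _ _ => rfl) (fun _ _ => rfl) rfl rfl _ (fun l hl => by simpa [NH.mag] using (hG l hl).2.2.1)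
  · exact e2 AccV.g3P AccV.g3N (fun _ _ => rfl) (fun _ _ => rfl) rfl rfl _ (fun l hl => by simpa [NH.mag] using (hG l hl).2.2.2.1)
  · exact e2 AccV.g4P AccV.g4N (fun _ _ => rfl) (fun _ _ => rfl) rfl rfl _ (fun l hl => by simpa [NH.mag] using (hG l hl).2.2.2.2.1)
  · exact e2 AccV.g5P AccV.g5N (fun _ _ => rfl) (fun _ _ => rfl) rfl rfl _ (fun l hl => by simpa [NH.mag] using (hG l hl).2.2.2.2.2.1)
  · exact e2 AccV.g6P AccV.g6N (fun _ _ => rfl) (fun _ _ => rfl) rfl rfl _ (fun l hl => by simpa [NH.mag] using (hG l hl).2.2.2.2.2.2.1)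
  · exact e2 AccV.g7P AccV.g7N (fun _ _ => rfl) (fun _ _ => rfl) rfl rfl _ (fun l hl => by simpa [NH.mag] using (hG l hl).2.2.2.2.2.2.2.1)
  · exact e2 AccV.g8P AccV.g8N (fun _ _ => rfl) (fun _ _ => rfl) rfl rfl _ (fun l hl => by simpa [NH.mag] using (hG l hl).2.2.2.2.2.2.2.2.1)
  · exact e2 AccV.g9P AccV.g9N (fun _ _ => rfl) (fun _ _ => rfl) rfl rfl _ (fun l hl => by simpa [NH.mag] using (hG l hl).2.2.2.2.2.2.2.2.2)

end Summit.AtomisticToContinuum.Crystallization.Theorems.FrustratedLawDichotomyStrainedPatchHomLeafTableCheckHcpV
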